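/-
Copyright (c) 2026 the pub-hodgecm-mathlib formalisation cell (harness21).  Prover seat hodgecm-mathlib-K2Liu-p09 (g6): Track B «K2-LIT»,
hLiu418 = stmt-HodgeConjecture-24832; LEAD F0P6-plan RULING M-158d «A7-val road (σ)», instance layer I-4b v2 (THE ASSEMBLY with the null-cone sockets of K2Liu-p02 and the TD sockets discharged).
-/
import Summits.HodgeConjecture.HodgeConjecture.Theorems.K2LiuA7ValueInstanceFace          -- ★ I-4b p860863 (`faceA4R_two_of_record`)
import Summits.HodgeConjecture.HodgeConjecture.Theorems.K2LiuA7ValueUnipotentPinsHerm     -- ★ K2Liu-p02 (g7) p860905 (`qHerm`, `continuous_qHerm`, `qHerm_rhoLoc_eq_zero`, `qHerm_leviRhoLoc_eq_zero`, `exists_leviRhoLoc_rhoLoc_eq_of_qHerm`)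
import Summits.HodgeConjecture.HodgeConjecture.Theorems.K2LiuLocalPiTotallyDisconnected   -- ★ p860887 (`totallyDisconnectedSpace_localPi`)
import HarnessLib

/-!
# Crux `HLiu418`, road `K2_Liu`, organ A7-val, instance layer I-4b v2: THE ASSEMBLY, SOCKETS `q hq hNρ hNa htrans` AND `[TotallyDisconnectedSpace]` DISCHARGED

Cell `hodgecm-mathlib`, crux item hLiu418 = `stmt-HodgeConjecture-24832`; squad K2 ∕ K2Liu; prover K2Liu-p09 (g6), organ lead A7-val.  THEOREMS ONLY; lane
`--supports stmt-HodgeConjecture-24832` (count-neutral helper).  The face (A4″-KR) at `n = 2`, `M₂ = 3`: the K2Lit CM datum `(L, e, dV, dW)` with `e : Fin N × Fin M ≃ Fin 2`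
(`H_v = U(𝔻)(L⁺_v) = U(2,2)`), `V′ = (L³, diag dV′)`, the Weil datum of record `(χ, 𝔪, 𝓕)` of the big datum `𝔻 ⊗ V′` and a normalised Δ-intertwiner `Γ` (★ β-3).
* **`faceA4R_two_of_record_v2`** — ★ I-4b `faceA4R_two_of_record` with five more sockets paid: `q := qHerm` (★ K2Liu-p02 (g7) `K2LiuA7ValueUnipotentPinsHerm`,
  `ι := Fin 4`), `hq := continuous_qHerm`, `hNρ := qHerm_rhoLoc_eq_zero`, `hNa := qHerm_leviRhoLoc_eq_zero`, `htrans := exists_leviRhoLoc_rhoLoc_eq_of_qHerm` (at a NON-SPLIT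
  place: new hypotheses `hc1`, `w₀`, `hw₀`), and the two `[TotallyDisconnectedSpace …]` instances (★ `totallyDisconnectedSpace_localPi`).  Remaining sockets: the small
  side `χv′ hχ′ B hB hSiegS` + `K₁ hK₁ a₀ hK₁χ` (K2Liu-p10, ★ `hK₁χ_of_laws` reduces the latter), `U(V′_v)` data `P′ hP′ μG μP hBP hBcont` + five instances (K2Liu-p11),
  the unipotent pins `nΔ hnΔ ψ hm hN` (K2Liu-p02 FILE 2b), the witnesses `hne hBne` (K2Liu-p07∕p08, ★ V8g).
HONEST LABEL.  `HC_CM` is proved only modulo the 7 printed citations (2 remaining named inputs: hLiu418 = `stmt-HodgeConjecture-24832`,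
h413 = `stmt-HodgeConjecture-24833`) until rung 0 closes.

## References
* [GanQiuTakeda2014] W. T. Gan, Y. Qiu, S. Takeda, Invent. Math. 198 (2014), §2.7–2.8, §5.4–§5.5.
* [KudlaRallis1994] S. Kudla, S. Rallis, Ann. of Math. 140 (1994), §1.
* [Kudla1994] S. Kudla, Israel J. Math. 87 (1994), §3 Thm. 3.1.
* [MoeglinVignerasWaldspurger1987] C. Mœglin, M.-F. Vignéras, J.-L. Waldspurger, LNM 1291, Chap. 2 II.6.
-/

set_option autoImplicit false
set_option linter.dupNamespace false -- the mandated namespace repeats `HodgeConjecture.HodgeConjecture`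

noncomputable section

open scoped Matrix Classical NNReal ENNReal
open NumberField IsDedekindDomain MeasureTheory MeasureTheory.Measure Topology
open Literature.NumberTheory.GaloisRepresentations Literature.NumberTheory.GaloisRepresentations.IsNonarchimedeanLocalField
open Literature.NumberTheory.Automorphic Literature.NumberTheory.Automorphic.UnitaryGroup
open Literature.NumberTheory.GelbartRogawski1991 Literature.NumberTheory.GelbartRogawski1991.GRConstruction
open Literature.NumberTheory.GelbartRogawski1991.UnitaryDualPair
open Literature.NumberTheory.GelbartRogawski1991.UnitaryDualPair.LocalSplitting
open Literature.NumberTheory.K2Lit.SiegelDoubled Literature.NumberTheory.K2Lit.LocalSiegelDoubled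
open Literature.RepresentationTheory.HeisenbergGroup
open Summit.HodgeConjecture.HodgeConjecture.Cruxes.HLiu418.K2LiuQRationalDefs
open Summit.HodgeConjecture.HodgeConjecture.Cruxes.HLiu418.K2LiuLocalLFactorDefs
open Summit.HodgeConjecture.HodgeConjecture.Cruxes.HLiu418.K2LiuLocalSiegel
open Summit.HodgeConjecture.HodgeConjecture.Cruxes.HLiu418.K2LiuLocalIntertwiningProperty
open Summit.HodgeConjecture.HodgeConjecture.Cruxes.HLiu418.K2LiuA7ValueFaceTwo
open Summit.HodgeConjecture.HodgeConjecture.Cruxes.HLiu418.K2LiuDoublingSchrodingerModelDefs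
open Summit.HodgeConjecture.HodgeConjecture.Cruxes.HLiu418.K2LiuDoublingModelComparison
open Summit.HodgeConjecture.HodgeConjecture.Cruxes.HLiu418.K2LiuLocalSWSectionDefs
open Summit.HodgeConjecture.HodgeConjecture.Cruxes.HLiu418.K2LiuSWSectionPlaceFactorisation
open Summit.HodgeConjecture.HodgeConjecture.Cruxes.HLiu418.K2LiuSWSectionTensorPlaceFactorisation
open Summit.HodgeConjecture.HodgeConjecture.Cruxes.HLiu418.K2LiuA7ValueInstanceDefs
open Summit.HodgeConjecture.HodgeConjecture.Cruxes.HLiu418.K2LiuA7ValueInstanceLeviLaw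
open Summit.HodgeConjecture.HodgeConjecture.Cruxes.HLiu418.K2LiuA7ValueInstancePartnerLaws
open Summit.HodgeConjecture.HodgeConjecture.Cruxes.HLiu418.K2LiuA7ValueInstanceSectionMap
open Summit.HodgeConjecture.HodgeConjecture.Cruxes.HLiu418.K2LiuA7ValueInstanceTopology

open Summit.HodgeConjecture.HodgeConjecture.Cruxes.HLiu418.K2LiuA7ValueInstanceFace
open Summit.HodgeConjecture.HodgeConjecture.Cruxes.HLiu418.K2LiuA7ValueUnipotentPinsHerm
open Summit.HodgeConjecture.HodgeConjecture.Cruxes.HLiu418.K2LiuLocalPiTotallyDisconnected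

namespace Summit.HodgeConjecture.HodgeConjecture.Cruxes.HLiu418.K2LiuA7ValueInstanceFaceV2

variable (L : Type) [Field L] [NumberField L] [IsCMField L] [Algebra.IsQuadraticExtension (Fp L) L]
variable {N M : ℕ} (e : Fin N × Fin M ≃ Fin 2)
  (dV : Fin N → L) (hdV : ∀ i, IsCMField.complexConj L (dV i) = dV i) (hdV0 : ∀ i, dV i ≠ 0)
  (dW : Fin M → L) (hdW : ∀ i, IsCMField.complexConj L (dW i) = dW i) (hdW0 : ∀ i, dW i ≠ 0)
variable {M' n' : ℕ} (eW : Fin M × Fin 3 ≃ Fin M') (e' : Fin N × Fin M' ≃ Fin n')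
  (dV' : Fin 3 → L) (hdV' : ∀ k, IsCMField.complexConj L (dV' k) = dV' k) (hdV'0 : ∀ k, dV' k ≠ 0) (hM₂ : (3 : ℕ) ≠ 0)
variable (χ : HeckeCharacter L) (𝔪 : ∀ v, PlaceMeasure L v)
  (𝓕 : FinLocalFamily L e' dV hdV hdV0 (tensorFrame L dW eW dV') (tensorFrame_real L dW hdW eW dV' hdV') (tensorFrame_ne_zero L dW eW dV' hdW0 hdV'0) χ 𝔪)
  (v : HeightOneSpectrum (𝓞 (Fp L)))
  [MeasurableSpace (Fin n' → v.adicCompletion (Fp L))] [BorelSpace (Fin n' → v.adicCompletion (Fp L))]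
  (μ : Measure (Fin n' → v.adicCompletion (Fp L))) [μ.IsAddHaarMeasure]
  (Γ : SchwartzBruhat (Fin (n' + n') → v.adicCompletion (Fp L)) ≃ₗ[ℂ] SchwartzBruhat (Fin (n' + n') → v.adicCompletion (Fp L)))
  (hΓ : IsDeltaIntertwiner L e' dV hdV (tensorFrame L dW eW dV') (tensorFrame_real L dW hdW eW dV' hdV') v Γ)
  (hΓ0 : ∀ Ψ : SchwartzBruhat (Fin (n' + n') → v.adicCompletion (Fp L)),
    ((Γ Ψ : SchwartzBruhat (Fin (n' + n') → v.adicCompletion (Fp L))) : (Fin (n' + n') → v.adicCompletion (Fp L)) → ℂ) 0 =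
      diagIntegral (GRConstruction.e₂ (n := n')) μ Ψ)
  (hs₀ : (1 / 2 : ℂ) = (((3 : ℕ) : ℂ) - ((2 : ℕ) : ℂ)) / 2)

set_option maxHeartbeats 1600000 in -- as ★ I-4b (measured)
include hdV0 hdW0 hdV'0 hM₂ μ hΓ0 hs₀ in
/-- **THE FACE (A4″-KR) AT THE INSTANCE OF RECORD, v2** — ★ I-4b with the null-cone sockets (★ K2Liu-p02 `qHerm` file) and the `[TotallyDisconnectedSpace]` sockets
(★ `totallyDisconnectedSpace_localPi`) paid; non-split place (`hc1`, `w₀`, `hw₀`). [cite: GanQiuTakeda2014, §2.7–2.8] [cite: Kudla1994, §3 Thm. 3.1] -/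
theorem faceA4R_two_of_record_v2
  (hc1 : IsCMField.complexConj L ≠ 1) (w₀ : UnitaryGroup.PlacesOver L v) (hw₀ : IsCMField.complexConj L • w₀.1 = w₀.1)
  (χv' : ∀ w : UnitaryGroup.PlacesOver L v, (w.1.adicCompletion L)ˣ →* ℂˣ)
  (hχ' : ∀ (w w' : UnitaryGroup.PlacesOver L v) (h : IsCMField.complexConj L • w.1 = w'.1),
    χv' w = ((fun w : UnitaryGroup.PlacesOver L v => (χ ^ 3).localComponent w.1) w')⁻¹.comp (Units.map (galAdicCompletionMap (L := L) (IsCMField.complexConj L) h : w.1.adicCompletion L →* w'.1.adicCompletion L)))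
  [MeasurableSpace (unipDeltaLocal (Fp L) L (IsCMField.complexConj L) v 2 (JD := hermD L e dV hdV dW hdW))]
  [BorelSpace (unipDeltaLocal (Fp L) L (IsCMField.complexConj L) v 2 (JD := hermD L e dV hdV dW hdW))]
  (νN : Measure (unipDeltaLocal (Fp L) L (IsCMField.complexConj L) v 2 (JD := hermD L e dV hdV dW hdW))) [νN.IsHaarMeasure]
  -- the small side (K2Liu-p10: (L2)∕(L3)∕S-2a) by value
  (B : SchwartzBruhat (Fin (n' + n') → v.adicCompletion (Fp L)) →ₗ[ℂ] (UnitaryGroup.localPi L (IsCMField.complexConj L) (2 + 2) (hermD L e dV hdV dW hdW) v → ℂ))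
  (hB : ∀ (u : UnitaryGroup.localPi L (IsCMField.complexConj L) (2 + 2) (hermD L e dV hdV dW hdW) v) (Φ : SchwartzBruhat (Fin (n' + n') → v.adicCompletion (Fp L))) (h : UnitaryGroup.localPi L (IsCMField.complexConj L) (2 + 2) (hermD L e dV hdV dW hdW) v),
    B (MpPsi.toRep (localSchrodingerDelta L e' dV hdV (tensorFrame L dW eW dV') (tensorFrame_real L dW hdW eW dV' hdV') v) (((mpTransportLoc L e' dV hdV (tensorFrame L dW eW dV') (tensorFrame_real L dW hdW eW dV' hdV') v Γ hΓ).toMonoidHom.comp (((finSplittings L e' dV hdV hdV0 (tensorFrame L dW eW dV') (tensorFrame_real L dW hdW eW dV' hdV') (tensorFrame_ne_zero L dW eW dV' hdW0 hdV'0) χ 𝔪 𝓕).s v).comp (tensorEmbLoc L e dV hdV dW hdW eW e' dV' hdV' v))) u) Φ) h = B Φ (h * u))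
  (hSiegS : ∀ Φ : SchwartzBruhat (Fin (n' + n') → v.adicCompletion (Fp L)), IsLocalSiegelSection (Fp L) L (IsCMField.complexConj L) (complexConj_imagUnit L) (imagUnit_ne_zero L) (imagUnit_mul_self L) v 2 (gramR_isSymm L e dV hdV dW hdW) (hermD_eq_map_gramD L e dV hdV dW hdW) χv' (-(1 / 2)) (B Φ))
  -- `G = U(V′_v)` (K2Liu-p11∕p12∕p17: instances and the `P′`-average data) by value
  [SigmaCompactSpace (UnitaryGroup.localPi L (IsCMField.complexConj L) 3 (Matrix.diagonal dV') v)] [LocallyCompactSpace (UnitaryGroup.localPi L (IsCMField.complexConj L) 3 (Matrix.diagonal dV') v)] [T2Space (UnitaryGroup.localPi L (IsCMField.complexConj L) 3 (Matrix.diagonal dV') v)]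
  [SecondCountableTopology (UnitaryGroup.localPi L (IsCMField.complexConj L) 3 (Matrix.diagonal dV') v)] [MeasurableSpace (UnitaryGroup.localPi L (IsCMField.complexConj L) 3 (Matrix.diagonal dV') v)] [BorelSpace (UnitaryGroup.localPi L (IsCMField.complexConj L) 3 (Matrix.diagonal dV') v)]
  (P' : Subgroup (UnitaryGroup.localPi L (IsCMField.complexConj L) 3 (Matrix.diagonal dV') v)) (hP' : IsClosed (P' : Set (UnitaryGroup.localPi L (IsCMField.complexConj L) 3 (Matrix.diagonal dV') v))) [LocallyCompactSpace ↥P']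
  (μG : Measure (UnitaryGroup.localPi L (IsCMField.complexConj L) 3 (Matrix.diagonal dV') v)) [μG.IsHaarMeasure] [μG.IsMulRightInvariant] (μP : Measure ↥P') [μP.IsHaarMeasure]
  (hBP : ∀ (p : ↥P') (Φ : SchwartzBruhat (Fin (n' + n') → v.adicCompletion (Fp L))) (h : UnitaryGroup.localPi L (IsCMField.complexConj L) (2 + 2) (hermD L e dV hdV dW hdW) v),
    B (leviEquivSB (rhoLoc L (complexConj_imagUnit L) (imagUnit_ne_zero L) e dV hdV dW hdW eW e' dV' hdV' v (p : UnitaryGroup.localPi L (IsCMField.complexConj L) 3 (Matrix.diagonal dV') v)) (continuous_rhoLoc L e dV hdV dW hdW eW e' dV' hdV' v _).1 (continuous_rhoLoc L e dV hdV dW hdW eW e' dV' hdV' v _).2 Φ) h = (((modularCharacter p : ℝ≥0) : ℝ) : ℂ) * B Φ h)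
  (hBcont : ∀ (Φ : SchwartzBruhat (Fin (n' + n') → v.adicCompletion (Fp L))) (h : UnitaryGroup.localPi L (IsCMField.complexConj L) (2 + 2) (hermD L e dV hdV dW hdW) v),
    Continuous fun x : UnitaryGroup.localPi L (IsCMField.complexConj L) 3 (Matrix.diagonal dV') v => B (leviEquivSB (rhoLoc L (complexConj_imagUnit L) (imagUnit_ne_zero L) e dV hdV dW hdW eW e' dV' hdV' v x) (continuous_rhoLoc L e dV hdV dW hdW eW e' dV' hdV' v x).1 (continuous_rhoLoc L e dV hdV dW hdW eW e' dV' hdV' v x).2 Φ) h)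
  (K₁ : Subgroup ↥(leviDeltaLoc L e dV hdV dW hdW v)) (hK₁ : IsCompact (K₁ : Set ↥(leviDeltaLoc L e dV hdV dW hdW v)) ∧ IsOpen (K₁ : Set ↥(leviDeltaLoc L e dV hdV dW hdW v)))
  (a₀ : ↥(leviDeltaLoc L e dV hdV dW hdW v))
  (hK₁χ : ∀ cM : ↥(leviDeltaLoc L e dV hdV dW hdW v) →* ℂˣ, (∀ (a : ↥(leviDeltaLoc L e dV hdV dW hdW v)) (Φ : SchwartzBruhat (Fin (n' + n') → v.adicCompletion (Fp L))), MpPsi.toRep (localSchrodingerDelta L e' dV hdV (tensorFrame L dW eW dV') (tensorFrame_real L dW hdW eW dV' hdV') v) (((mpTransportLoc L e' dV hdV (tensorFrame L dW eW dV') (tensorFrame_real L dW hdW eW dV' hdV') v Γ hΓ).toMonoidHom.comp (((finSplittings L e' dV hdV hdV0 (tensorFrame L dW eW dV') (tensorFrame_real L dW hdW eW dV' hdV') (tensorFrame_ne_zero L dW eW dV' hdW0 hdV'0) χ 𝔪 𝓕).s v).comp (tensorEmbLoc L e dV hdV dW hdW eW e' dV' hdV' v))) (a : UnitaryGroup.localPi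 L (IsCMField.complexConj L) (2 + 2) (hermD L e dV hdV dW hdW) v)) Φ = (cM a : ℂ) • leviEquivSB (leviRhoLoc L (complexConj_imagUnit L) (imagUnit_ne_zero L) e dV hdV dW hdW eW e' dV' hdV' v a) (continuous_leviRhoLoc L e dV hdV dW hdW eW e' dV' hdV' v a).1 (continuous_leviRhoLoc L e dV hdV dW hdW eW e' dV' hdV' v a).2 Φ) →
    (∀ a ∈ K₁, (cM a : ℂ) = localSiegelCharacter (Fp L) L (IsCMField.complexConj L) v 2 χv' (-(1 / 2)) ((a : UnitaryGroup.localPi L (IsCMField.complexConj L) (2 + 2) (hermD L e dV hdV dW hdW) v))) ∧ (cM a₀ : ℂ) ≠ localSiegelCharacter (Fp L) L (IsCMField.complexConj L) v 2 χv' (-(1 / 2)) ((a₀ : UnitaryGroup.localPi L (IsCMField.complexConj L) (2 + 2) (hermD L e dV hdV dW hdW) v)))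
  (nΔ : (Fin 4 → v.adicCompletion (Fp L)) → UnitaryGroup.localPi L (IsCMField.complexConj L) (2 + 2) (hermD L e dV hdV dW hdW) v)
  (hnΔ : ∀ η, nΔ η ∈ unipDeltaLocal (Fp L) L (IsCMField.complexConj L) v 2 (JD := hermD L e dV hdV dW hdW))
  (ψ : AddChar (v.adicCompletion (Fp L)) Circle) {m : ℤ} (hm : ψ.HasConductorExp m)
  (hN : ∀ (η : Fin 4 → v.adicCompletion (Fp L)) (Φ : SchwartzBruhat (Fin (n' + n') → v.adicCompletion (Fp L))) (x : Fin (n' + n') → v.adicCompletion (Fp L)),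
    ((MpPsi.toRep (localSchrodingerDelta L e' dV hdV (tensorFrame L dW eW dV') (tensorFrame_real L dW hdW eW dV' hdV') v) (((mpTransportLoc L e' dV hdV (tensorFrame L dW eW dV') (tensorFrame_real L dW hdW eW dV' hdV') v Γ hΓ).toMonoidHom.comp (((finSplittings L e' dV hdV hdV0 (tensorFrame L dW eW dV') (tensorFrame_real L dW hdW eW dV' hdV') (tensorFrame_ne_zero L dW eW dV' hdW0 hdV'0) χ 𝔪 𝓕).s v).comp (tensorEmbLoc L e dV hdV dW hdW eW e' dV' hdV' v))) (nΔ η)) Φ : SchwartzBruhat (Fin (n' + n') → v.adicCompletion (Fp L))) : (Fin (n' + n') → v.adicCompletion (Fp L)) → ℂ) x =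
      ((ψ (η ⬝ᵥ qHerm L (complexConj_imagUnit L) (imagUnit_ne_zero L) e eW e' dV' v x) : Circle) : ℂ) * (Φ : (Fin (n' + n') → v.adicCompletion (Fp L)) → ℂ) x)
  (hne : ∀ (K₀ : Subgroup (UnitaryGroup.localPi L (IsCMField.complexConj L) (2 + 2) (hermD L e dV hdV dW hdW) v)),
    IsCompact (K₀ : Set (UnitaryGroup.localPi L (IsCMField.complexConj L) (2 + 2) (hermD L e dV hdV dW hdW) v)) ∧ IsOpen (K₀ : Set (UnitaryGroup.localPi L (IsCMField.complexConj L) (2 + 2) (hermD L e dV hdV dW hdW) v)) →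
    (∀ x : UnitaryGroup.localPi L (IsCMField.complexConj L) (2 + 2) (hermD L e dV hdV dW hdW) v, ∃ p, IsSiegelDelta (Fp L) L (IsCMField.complexConj L) (complexConj_imagUnit L) (imagUnit_ne_zero L) (imagUnit_mul_self L) v 2 (gramR_isSymm L e dV hdV dW hdW) (hermD_eq_map_gramD L e dV hdV dW hdW) p ∧ ∃ k ∈ K₀, x = p * k) →
    ∃ (Φ₀ : SchwartzBruhat (Fin (n' + n') → v.adicCompletion (Fp L))) (f Fn : ℂ → UnitaryGroup.localPi L (IsCMField.complexConj L) (2 + 2) (hermD L e dV hdV dW hdW) v → ℂ),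
      (∀ s, IsLocalSiegelSection (Fp L) L (IsCMField.complexConj L) (complexConj_imagUnit L) (imagUnit_ne_zero L) (imagUnit_mul_self L) v 2 (gramR_isSymm L e dV hdV dW hdW) (hermD_eq_map_gramD L e dV hdV dW hdW) (fun w : UnitaryGroup.PlacesOver L v => (χ ^ 3).localComponent w.1) s (f s)) ∧ (∀ s, IsSmooth (Fp L) L (IsCMField.complexConj L) v 2 (f s)) ∧ (∀ s s' : ℂ, ∀ k ∈ K₀, f s k = f s' k) ∧
      f (1 / 2) = ((sectionMapLoc L e dV hdV hdV0 dW hdW hdW0 eW e' dV' hdV' hdV'0 hM₂ χ 𝔪 𝓕 v μ Γ hΓ hΓ0 (1 / 2) hs₀ Φ₀ : ↥(localDegPS (Fp L) L (IsCMField.complexConj L) (complexConj_imagUnit L) (imagUnit_ne_zero L) (imagUnit_mul_self L) v 2 (gramR_isSymm L e dV hdV dW hdW) (hermD_eq_map_gramD L e dV hdV dW hdW) (fun w : UnitaryGroup.PlacesOver L v => (χ ^ 3).localComponent w.1) (1 / 2))) : UnitaryGroup.localPi L (IsCMField.complexConj L) (2 + 2) (hermD L e dV hdV dW hdW) v → ℂ)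 ∧
      (∀ h, IsQRationalRegularAt (residueFieldCard (v.adicCompletion (Fp L))) (1 / 2) fun s => Fn s h) ∧
      (∀ s : ℂ, 1 < s.re → ∀ h, localIntertwining (Fp L) L (IsCMField.complexConj L) v 2 (hermD_eq_map_gramD L e dV hdV dW hdW) νN (f s) h =
        aNorm (Fp L) L (IsCMField.complexConj L) v 2 (fun w : UnitaryGroup.PlacesOver L v => (χ ^ 3).localComponent w.1) (νN.real {u | (u : UnitaryGroup.localPi L (IsCMField.complexConj L) (2 + 2) (hermD L e dV hdV dW hdW) v) ∈ K₀}) s * Fn s h) ∧ Fn (1 / 2) 1 ≠ 0)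
  (hBne : ∀ K' : Subgroup (UnitaryGroup.localPi L (IsCMField.complexConj L) 3 (Matrix.diagonal dV') v), IsCompact (K' : Set (UnitaryGroup.localPi L (IsCMField.complexConj L) 3 (Matrix.diagonal dV') v)) ∧ IsOpen (K' : Set (UnitaryGroup.localPi L (IsCMField.complexConj L) 3 (Matrix.diagonal dV') v)) →
    ∃ Φ₁ : SchwartzBruhat (Fin (n' + n') → v.adicCompletion (Fp L)), (∀ k ∈ K', leviOp (rhoLoc L (complexConj_imagUnit L) (imagUnit_ne_zero L) e dV hdV dW hdW eW e' dV' hdV' v k) (Φ₁ : (Fin (n' + n') → v.adicCompletion (Fp L)) → ℂ) = Φ₁) ∧ B Φ₁ 1 ≠ 0)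

    :
    ∀ (_hχ : ∀ (w' : UnitaryGroup.PlacesOver L v) (x : (w'.1.adicCompletion L)ˣ), ‖(((fun w : UnitaryGroup.PlacesOver L v => (χ ^ 3).localComponent w.1) w' x : ℂˣ) : ℂ)‖ = 1)
      (K₀ : Subgroup (UnitaryGroup.localPi L (IsCMField.complexConj L) (2 + 2) (hermD L e dV hdV dW hdW) v))
      (_hK₀ : IsCompact (K₀ : Set (UnitaryGroup.localPi L (IsCMField.complexConj L) (2 + 2) (hermD L e dV hdV dW hdW) v)) ∧ IsOpen (K₀ : Set (UnitaryGroup.localPi L (IsCMField.complexConj L) (2 + 2) (hermD L e dV hdV dW hdW) v)))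
      (_hIw₀ : ∀ x : UnitaryGroup.localPi L (IsCMField.complexConj L) (2 + 2) (hermD L e dV hdV dW hdW) v, ∃ p, IsSiegelDelta (Fp L) L (IsCMField.complexConj L) (complexConj_imagUnit L) (imagUnit_ne_zero L) (imagUnit_mul_self L) v 2 (gramR_isSymm L e dV hdV dW hdW) (hermD_eq_map_gramD L e dV hdV dW hdW) p ∧ ∃ k ∈ K₀, x = p * k)
      (K' : Subgroup (UnitaryGroup.localPi L (IsCMField.complexConj L) 3 (Matrix.diagonal dV') v)) (_hK' : IsCompact (K' : Set (UnitaryGroup.localPi L (IsCMField.complexConj L) 3 (Matrix.diagonal dV') v)) ∧ IsOpen (K' : Set (UnitaryGroup.localPi L (IsCMField.complexConj L) 3 (Matrix.diagonal dV') v))) (_hIw : ∀ g : UnitaryGroup.localPi L (IsCMField.complexConj L) 3 (Matrix.diagonal dV') v, ∃ p ∈ P', ∃ k ∈ K', g = p * k),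
    ∃ cv : ℂ, cv ≠ 0 ∧ ∀ Φ : SchwartzBruhat (Fin (n' + n') → v.adicCompletion (Fp L)),
      (∀ k ∈ K', leviOp (rhoLoc L (complexConj_imagUnit L) (imagUnit_ne_zero L) e dV hdV dW hdW eW e' dV' hdV' v k) (Φ : (Fin (n' + n') → v.adicCompletion (Fp L)) → ℂ) = Φ) →
      ∀ (h : UnitaryGroup.localPi L (IsCMField.complexConj L) (2 + 2) (hermD L e dV hdV dW hdW) v) (f : ℂ → UnitaryGroup.localPi L (IsCMField.complexConj L) (2 + 2) (hermD L e dV hdV dW hdW) v → ℂ),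
        (∀ s, IsLocalSiegelSection (Fp L) L (IsCMField.complexConj L) (complexConj_imagUnit L) (imagUnit_ne_zero L) (imagUnit_mul_self L) v 2 (gramR_isSymm L e dV hdV dW hdW) (hermD_eq_map_gramD L e dV hdV dW hdW) (fun w : UnitaryGroup.PlacesOver L v => (χ ^ 3).localComponent w.1) s (f s)) → (∀ s, IsSmooth (Fp L) L (IsCMField.complexConj L) v 2 (f s)) →
        (∀ s s' : ℂ, ∀ k ∈ K₀, f s k = f s' k) →
        f (1 / 2) = ((sectionMapLoc L e dV hdV hdV0 dW hdW hdW0 eW e' dV' hdV' hdV'0 hM₂ χ 𝔪 𝓕 v μ Γ hΓ hΓ0 (1 / 2) hs₀ Φ : ↥(localDegPS (Fp L) L (IsCMField.complexConj L) (complexConj_imagUnit L) (imagUnit_ne_zero L) (imagUnit_mul_self L) v 2 (gramR_isSymm L e dV hdV dW hdW) (hermD_eq_map_gramD L e dV hdV dW hdW) (fun w : UnitaryGroup.PlacesOver L v => (χ ^ 3).localComponent w.1) (1 / 2))) : UnitaryGroup.localPi L (IsCMField.complexConj L) (2 + 2) (hermD L e dV hdV dW hdW) v → ℂ) →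
        ∃ Fn : ℂ → ℂ, IsQRationalRegularAt (residueFieldCard (v.adicCompletion (Fp L))) (1 / 2) Fn ∧
          (∀ s : ℂ, 1 < s.re → localIntertwining (Fp L) L (IsCMField.complexConj L) v 2 (hermD_eq_map_gramD L e dV hdV dW hdW) νN (f s) h =
            aNorm (Fp L) L (IsCMField.complexConj L) v 2 (fun w : UnitaryGroup.PlacesOver L v => (χ ^ 3).localComponent w.1) (νN.real {u | (u : UnitaryGroup.localPi L (IsCMField.complexConj L) (2 + 2) (hermD L e dV hdV dW hdW) v) ∈ K₀}) s * Fn s) ∧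
          Fn (1 / 2) = cv * B Φ h := by
  haveI : TotallyDisconnectedSpace (UnitaryGroup.localPi L (IsCMField.complexConj L) (2 + 2) (hermD L e dV hdV dW hdW) v) :=
    totallyDisconnectedSpace_localPi (Fp L) L (IsCMField.complexConj L) (2 + 2) (hermD L e dV hdV dW hdW) v
  haveI : TotallyDisconnectedSpace (UnitaryGroup.localPi L (IsCMField.complexConj L) 3 (Matrix.diagonal dV') v) :=
    totallyDisconnectedSpace_localPi (Fp L) L (IsCMField.complexConj L) 3 (Matrix.diagonal dV') v
  exact faceA4R_two_of_record L e dV hdV hdV0 dW hdW hdW0 eW e' dV' hdV' hdV'0 hM₂ χ 𝔪 𝓕 v μ Γ hΓ hΓ0 hs₀ χv' hχ' νN B hB hSiegS P' hP' μG μP hBP hBcont K₁ hK₁ a₀ hK₁χ nΔ hnΔ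
    (qHerm L (complexConj_imagUnit L) (imagUnit_ne_zero L) e eW e' dV' v) (continuous_qHerm L (complexConj_imagUnit L) (imagUnit_ne_zero L) e eW e' dV' v (n' := n')) ψ hm hN
    (fun g x hx => qHerm_rhoLoc_eq_zero L (complexConj_imagUnit L) (imagUnit_ne_zero L) e dV hdV dW hdW eW e' dV' hdV' v g x hx)
    (fun m x hx => qHerm_leviRhoLoc_eq_zero L (complexConj_imagUnit L) (imagUnit_ne_zero L) e dV hdV dW hdW eW e' dV' hdV' v m x hx)
    (fun x y hx hy hx0 hy0 => exists_leviRhoLoc_rhoLoc_eq_of_qHerm L (complexConj_imagUnit L) (imagUnit_ne_zero L) (imagUnit_mul_self L) e dV hdV dW hdW eW e' dV' hdV' v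
      (gramR_isSymm L e dV hdV dW hdW) (isUnit_det_gramR₀ L e dV hdV hdV0 dW hdW hdW0) (hermD_eq_map_gramD L e dV hdV dW hdW) hc1 w₀ hw₀ hdV'0 x y hx hy hx0 hy0)
    hne hBne

end Summit.HodgeConjecture.HodgeConjecture.Cruxes.HLiu418.K2LiuA7ValueInstanceFaceV2

end
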